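import Literature.NumberTheory.EllipticCurves.ShaPTorsionQuadraticSplitting
import HarnessLib

/-!
# The `p^n`-torsion layers: `#Sel_{p^∞}(E/F)[p^n] = p^{n·rank E(F)} · #Ш(E/F)[p^n]` in every rank, and the
# FINITENESS-FREE splitting `#Ш(E_K)[p^n] = #Ш(E)[p^n] · #Ш(E^{(c)})[p^n]` over `K = ℚ(√c)` for odd `p`, every `n`

Topic `NumberTheory/EllipticCurves`; theorems only (no definition, no named fact, no `sorry`, no instance). Sequel of
`ShaPTorsionQuadraticSplitting` (the layer `n = 1`), one layer up and for all layers at once: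

* (private plumbing `PruferQuot.natCard_torsionBy_pow` — `#(ℚ_p/ℤ_p)[p^m] = p^m`);
  `natCard_torsionBy_pow_tensorPrufer` — `#(G ⊗ ℚ_p/ℤ_p)[p^n] = p^{n·rank_ℤ G}` for `G` finitely generated
  (Greenberg 1999 §1 p. 57, one layer up from the tree's `natCard_torsionBy_tensorPrufer`);
* `WeierstrassCurve.natCard_torsionBy_pow_selmerGroupPInfty_eq` — for an elliptic curve `E` over a number field `F`, any
  prime `p` and any `n`: `#Sel_{p^∞}(E/F)[p^n] = p^{n·rank E(F)} · #Ш(E/F)[p^n]`, with NO finiteness hypothesis on `Ш`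
  (the fundamental sequence `0 → E(F) ⊗ ℚ_p/ℤ_p → Sel_{p^∞} → Ш[p^∞] → 0`, Greenberg 1999 §2, stays exact on
  `p^n`-torsion because its kernel is `p^n`-divisible);
* `WeierstrassCurve.natCard_sha_torsionBy_pow_baseChange_quadratic_of_odd` — for `K = ℚ(θ)`, `θ² = c`, every ODD prime
  `p` and every `n`: **`#Ш(E_K)[p^n] = #Ш(E)[p^n] · #Ш(E^{(c)})[p^n]`**, finiteness-free (the comparison isomorphism
  `Sel_{p^∞}(E) × Sel_{p^∞}(E^{(c)}) ≅ Sel_{p^∞}(E_K)` of Dokchitser–Dokchitser 2010 Lemma 4.14, tree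
  `comparisonMap_bijective_of_odd`, and `rank E(K) = rank E + rank E^{(c)}`); discriminant form for the tree's models.

All layers together: over a quadratic field and for odd `p`, both the coranks and every finite layer of `Ш[p^∞]` split
numerically as curve × twist. At `p = 2` nothing is claimed.

## References

* R. Greenberg, *Iwasawa theory for elliptic curves*, LNM 1716 (1999), §1 p. 57, §2 pp. 62–63. [Greenberg1999LNM]
* T. Dokchitser, V. Dokchitser, On the Birch–Swinnerton-Dyer quotients modulo squares, Ann. of Math. 172 (2010),
  Lemma 4.14 (proof). [DokchitserDokchitserAnnals2010]
* D. Jetchev, C. Skinner, X. Wan, The BSD formula for elliptic curves of analytic rank one, Camb. J. Math. 5 (2017),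
  §7.4.1. [JetchevSkinnerWan2017]
* J. H. Silverman, *The Arithmetic of Elliptic Curves*, 2nd ed. (2009), X.4.2. [SilvermanAEC2009]
-/

noncomputable section

open scoped Classical TensorProduct AddSubgroup

universe u

namespace Literature.NumberTheory.EllipticCurves

section PruferPow

variable (p : ℕ) [hp : Fact p.Prime]

/-- `b • e_N = 0` in `ℚ_p/ℤ_p` iff `p^N ∣ b` (`e_N = [p^{-N}]`, the tree's `prufGen`). [folklore] -/
private theorem zsmul_prufGen_eq_zero_iff_pow_dvd (N : ℕ) (b : ℤ) :
    b • prufGen p N = 0 ↔ (p : ℤ) ^ N ∣ b := by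
  have hp0 : (p : ℚ_[p]) ≠ 0 := Nat.cast_ne_zero.mpr hp.out.ne_zero
  have hrepr : b • prufGen p N =
      ((((b : ℚ_[p]) / (p : ℚ_[p]) ^ N + ((0 : ℤ_[p]) : ℚ_[p]) : ℚ_[p])) : PruferQuot p) := by
    rw [PruferQuot.mk_int_div_pow_add]
    rfl
  rw [hrepr, QuotientAddGroup.eq_zero_iff, PadicInt.coe_zero, add_zero]
  constructor
  · intro h
    exact_mod_cast Padic.pow_dvd_of_int_div_pow_mem p N b h
  · rintro ⟨c, rfl⟩
    have : (((p : ℤ) ^ N * c : ℤ) : ℚ_[p]) / (p : ℚ_[p]) ^ N = ((c : ℤ_[p]) : ℚ_[p]) := by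
      push_cast
      rw [mul_div_cancel_left₀ _ (pow_ne_zero _ hp0)]
    rw [this]
    exact (c : ℤ_[p]).2

/-- **`#(ℚ_p/ℤ_p)[p^m] = p^m`**: the `p^m`-torsion of `ℚ_p/ℤ_p` is `ℤ·e_m ≅ ℤ/p^m` (the case `m = 1` is the tree's
`PruferQuot.natCard_torsionBy`). [folklore] -/
private theorem PruferQuot.natCard_torsionBy_pow (m : ℕ) :
    Nat.card ↥((PruferQuot p)[((p ^ m : ℕ) : ℤ)]) = p ^ m := by
  let f : ℤ →+ PruferQuot p := zmultiplesHom (PruferQuot p) (prufGen p m)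
  have hf : ∀ b : ℤ, f b = b • prufGen p m := fun b => rfl
  have hrange : f.range = (PruferQuot p)[((p ^ m : ℕ) : ℤ)] := by
    ext x
    rw [AddSubgroup.torsionBy.nsmul_iff]
    constructor
    · rintro ⟨b, rfl⟩
      rw [hf, smul_comm, ← natCast_zsmul, zsmul_prufGen_self, smul_zero]
    · intro hx
      obtain ⟨N, a, rfl⟩ := exists_eq_zsmul_prufGen p x
      rw [← natCast_zsmul, smul_smul, zsmul_prufGen_eq_zero_iff_pow_dvd] at hx
      rcases le_or_gt N m with hNm | hmN
      · refine ⟨a * (p ^ (m - N) : ℕ), ?_⟩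
        rw [hf, mul_smul, ← zsmul_prufGen_add p N (m - N), Nat.add_sub_cancel' hNm]
      · have hsplit : ((p ^ m : ℕ) : ℤ) * a = (p : ℤ) ^ m * a := by push_cast; ring
        rw [hsplit, show N = m + (N - m) by omega, pow_add] at hx
        obtain ⟨c, hc⟩ := (mul_dvd_mul_iff_left (pow_ne_zero m
          (Int.natCast_ne_zero.mpr hp.out.ne_zero))).mp hx
        refine ⟨c, ?_⟩
        rw [hf, hc, mul_comm, mul_smul, ← Int.natCast_pow, ← zsmul_prufGen_add p m (N - m),
          show m + (N - m) = N by omega]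
  have hker : f.ker = AddSubgroup.zmultiples ((p ^ m : ℕ) : ℤ) := by
    ext b
    rw [AddMonoidHom.mem_ker, hf, zsmul_prufGen_eq_zero_iff_pow_dvd, Int.mem_zmultiples_iff,
      Int.natCast_pow]
  rw [← hrange, Nat.card_congr (QuotientAddGroup.quotientKerEquivRange f).symm.toEquiv,
    Nat.card_congr (QuotientAddGroup.quotientAddEquivOfEq hker).toEquiv,
    Nat.card_congr (Int.quotientZMultiplesNatEquivZMod (p ^ m)).toEquiv, Nat.card_zmod]

/-- `G ⊗ ℚ_p/ℤ_p` is divisible by every power of `p`. [folklore] -/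
private theorem tensorPrufer_divisible_pow (G : Type*) [AddCommGroup G] (m : ℕ) (x : G ⊗[ℤ] PruferQuot p) :
    ∃ y : G ⊗[ℤ] PruferQuot p, p ^ m • y = x := by
  induction m generalizing x with
  | zero => exact ⟨x, by rw [pow_zero, one_smul]⟩
  | succ m ih =>
    obtain ⟨y, rfl⟩ := tensorPrufer_divisible p G x
    obtain ⟨z, rfl⟩ := ih y
    exact ⟨z, by rw [pow_succ, mul_comm, mul_smul]⟩

/-- **`#(G ⊗ ℚ_p/ℤ_p)[p^n] = p^{n · rank_ℤ G}`** for a finitely generated abelian group `G` (`G ⊗ ℚ_p/ℤ_p ≅ (ℚ_p/ℤ_p)^r`,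
`r = rank_ℤ G`; Greenberg 1999 §1 p. 57, one layer up from the tree's `natCard_torsionBy_tensorPrufer`).
[cite: Greenberg1999LNM, §1 p. 57] -/
theorem natCard_torsionBy_pow_tensorPrufer (G : Type*) [AddCommGroup G] [Module.Finite ℤ G] (n : ℕ) :
    Nat.card (G ⊗[ℤ] PruferQuot p)[((p ^ n : ℕ) : ℤ)] = p ^ (n * Module.finrank ℤ G) := by
  classical
  haveI : Module.IsTorsionFree ℤ (G ⧸ Submodule.torsion ℤ G) :=
    Submodule.QuotientTorsion.instIsTorsionFree
  haveI : Module.Finite ℤ (G ⧸ Submodule.torsion ℤ G) := Module.Finite.quotient ℤ _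
  haveI : Module.Free ℤ (G ⧸ Submodule.torsion ℤ G) := Module.free_of_finite_type_torsion_free'
  have hrank : Module.finrank ℤ (G ⧸ Submodule.torsion ℤ G) = Module.finrank ℤ G :=
    finrank_quotient_eq_of_le_torsion le_rfl
  let b := Module.finBasis ℤ (G ⧸ Submodule.torsion ℤ G)
  let e : G ⊗[ℤ] PruferQuot p ≃ₗ[ℤ]
      (Fin (Module.finrank ℤ (G ⧸ Submodule.torsion ℤ G)) →₀ PruferQuot p) :=
    tensorPruferEquivQuotTorsion p G ≪≫ₗ TensorProduct.congr b.repr (LinearEquiv.refl ℤ _) ≪≫ₗ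
      TensorProduct.finsuppScalarLeft ℤ (PruferQuot p) _
  let e' : G ⊗[ℤ] PruferQuot p ≃+ (Fin (Module.finrank ℤ (G ⧸ Submodule.torsion ℤ G)) → PruferQuot p) :=
    e.toAddEquiv.trans (Finsupp.linearEquivFunOnFinite ℤ (PruferQuot p) _).toAddEquiv
  rw [Nat.card_congr (torsionByEquiv e' (p ^ n)).toEquiv, natCard_torsionBy_pi, PruferQuot.natCard_torsionBy_pow,
    Nat.card_eq_fintype_card, Fintype.card_fin, hrank, ← pow_mul]

omit hp in
/-- `#(A[p^∞])[p^n] = #A[p^n]`: the `p^n`-torsion lies in the `p`-primary component. [folklore] -/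
private theorem natCard_torsionBy_pow_primaryComponent (A : Type*) [AddCommGroup A] (n : ℕ) :
    Nat.card ((AddCommGroup.primaryComponent A p)[((p ^ n : ℕ) : ℤ)]) = Nat.card (A[((p ^ n : ℕ) : ℤ)]) := by
  refine Nat.card_congr
    { toFun := fun x ↦ ⟨((x : AddCommGroup.primaryComponent A p) : A), ?_⟩
      invFun := fun y ↦ ⟨⟨(y : A), ?_⟩, ?_⟩
      left_inv := fun x ↦ rfl
      right_inv := fun y ↦ rfl }
  · have h := AddSubgroup.torsionBy.nsmul_iff.mp x.2
    rw [AddSubgroup.torsionBy.nsmul_iff, ← AddSubgroupClass.coe_nsmul, h, ZeroMemClass.coe_zero]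
  · exact (AddCommGroup.mem_primaryComponent).mpr ⟨n, AddSubgroup.torsionBy.nsmul_iff.mp y.2⟩
  · exact AddSubgroup.torsionBy.nsmul_iff.mpr (Subtype.ext (by
      rw [AddSubgroupClass.coe_nsmul, ZeroMemClass.coe_zero]; exact AddSubgroup.torsionBy.nsmul_iff.mp y.2))

end PruferPow

end Literature.NumberTheory.EllipticCurves

namespace WeierstrassCurve

open Literature.NumberTheory.EllipticCurves Literature.NumberTheory.QuadraticFields

section TorsionLayerPow

variable {F : Type u} [Field F] [NumberField F] (X : WeierstrassCurve F) [X.IsElliptic] (p : ℕ) [hp : Fact p.Prime]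

/-- **`#Sel_{p^∞}(E/F)[p^n] = p^{n · rank E(F)} · #Ш(E/F)[p^n]`** for an elliptic curve over a number field, any prime `p`
and any `n`, with no finiteness hypothesis on `Ш`: the fundamental sequence `0 → E(F) ⊗ ℚ_p/ℤ_p → Sel_{p^∞}(E/F) →
Ш(E/F)[p^∞] → 0` stays exact on `p^n`-torsion (its kernel is `p^n`-divisible) and `#(E(F) ⊗ ℚ_p/ℤ_p)[p^n] =
p^{n·rank}`. Deliberate dot-notation extension of Mathlib's `WeierstrassCurve` namespace.
[cite: Greenberg1999LNM, §2 pp. 62–63] [cite: SilvermanAEC2009, Thm. X.4.2(b)] -/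
theorem natCard_torsionBy_pow_selmerGroupPInfty_eq (n : ℕ) :
    Nat.card ((selmerGroupPInfty X p)[((p ^ n : ℕ) : ℤ)]) =
      p ^ (n * X.mordellWeilRank) * Nat.card (X.sha[((p ^ n : ℕ) : ℤ)]) := by
  haveI : Module.Finite ℤ X.toAffine.Point := X.module_finite_point_holds
  have hdiv : X.zsmul_geomPoints_surjective := X.zsmul_geomPoints_surjective_holds
  set κ := kummerMapPInfty X p hdiv with hκ_def
  have hκinj : Function.Injective κ := kummerMapPInfty_injective X p hdiv
  have hκrange : κ.range = (primaryH1ToH1 X p).ker := range_kummerMapPInfty X p hdiv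
  have hmap : (selmerGroupPInfty X p).map (primaryH1ToH1 X p) =
      (AddCommGroup.primaryComponent X.sha p).map X.sha.subtype :=
    X.map_primaryH1ToH1_selmerGroupPInfty p hdiv
  set Sel := selmerGroupPInfty X p with hSel
  let f : Sel →+ X.galH1 := (primaryH1ToH1 X p).comp Sel.subtype
  have hkerle : (primaryH1ToH1 X p).ker ≤ Sel := ker_primaryH1ToH1_le_selmerGroupPInfty X p
  have hκmem : ∀ x, κ x ∈ Sel := fun x ↦ hkerle (hκrange ▸ ⟨x, rfl⟩)
  let i : X.toAffine.Point ⊗[ℤ] PruferQuot p →+ Sel := κ.codRestrict Sel hκmem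
  have hrange : f.range = (AddCommGroup.primaryComponent X.sha p).map X.sha.subtype := by
    rw [← hmap, AddMonoidHom.range_comp, AddSubgroup.range_subtype]
  let e : f.range ≃+ AddCommGroup.primaryComponent X.sha p :=
    (AddEquiv.addSubgroupCongr hrange).trans
      (AddSubgroup.equivMapOfInjective (AddCommGroup.primaryComponent X.sha p) X.sha.subtype
        Subtype.val_injective).symm
  have hcount := natCard_torsionBy_eq_mul (p := p ^ n) (i := i) (f := f.rangeRestrict) ?_
    f.rangeRestrict_surjective ?_ ?_ (tensorPrufer_divisible_pow p _ n)
  · rw [hcount, natCard_torsionBy_pow_tensorPrufer p X.toAffine.Point n,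
      Nat.card_congr (torsionByEquiv e (p ^ n)).toEquiv, natCard_torsionBy_pow_primaryComponent, mul_comm]
    rfl
  · intro x y hxy
    exact hκinj (congrArg (fun z : Sel ↦ (z : galH1Primary X p)) hxy)
  · intro a ha
    have ha' : primaryH1ToH1 X p (a : galH1Primary X p) = 0 :=
      congrArg (fun z : f.range ↦ (z : X.galH1)) ha
    have hmem : (a : galH1Primary X p) ∈ κ.range := hκrange ▸ ha'
    obtain ⟨x, hx⟩ := hmem
    exact ⟨x, Subtype.ext hx⟩
  · intro d
    apply Subtype.ext
    change primaryH1ToH1 X p (κ d) = 0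
    have : κ d ∈ (primaryH1ToH1 X p).ker := hκrange ▸ ⟨d, rfl⟩
    exact this

/-- **`#Ш(E/F)[p^n]` divides `#Sel_{p^∞}(E/F)[p^n]`**, the quotient being `p^{n·rank E(F)}`.
[cite: Greenberg1999LNM, §2 pp. 62–63] -/
theorem natCard_sha_torsionBy_pow_dvd_selmerGroupPInfty (n : ℕ) :
    Nat.card (X.sha[((p ^ n : ℕ) : ℤ)]) ∣ Nat.card ((selmerGroupPInfty X p)[((p ^ n : ℕ) : ℤ)]) :=
  ⟨p ^ (n * X.mordellWeilRank), by rw [natCard_torsionBy_pow_selmerGroupPInfty_eq, mul_comm]⟩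

end TorsionLayerPow

section QuadraticPow

variable (W : WeierstrassCurve ℚ) [W.IsElliptic] (K : Type) [Field K] [NumberField K]
  (h2 : Module.finrank ℚ K = 2) {θ : K} {c : ℚ} (hθ : θ ∉ Set.range (algebraMap ℚ K))
  (hc : θ ^ 2 = algebraMap ℚ K c)

include h2 hθ hc in
/-- **`#Ш(E_K/K)[p^n] = #Ш(E/ℚ)[p^n] · #Ш(E^{(c)}/ℚ)[p^n]` for every ODD prime `p` and every `n`, with NO finiteness
hypothesis** (`K = ℚ(θ)`, `θ² = c`): divide `#Sel_{p^∞}(E_K)[p^n] = #Sel_{p^∞}(E)[p^n] · #Sel_{p^∞}(E^{(c)})[p^n]` by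
`p^{n·rank E(K)} = p^{n·rank E(ℚ)} · p^{n·rank E^{(c)}(ℚ)}`. All layers together say that the finite parts AND the
coranks of `Ш[p^∞]` split (numerically) over a quadratic field for odd `p`.
[cite: DokchitserDokchitserAnnals2010, Lemma 4.14 (proof)] [cite: JetchevSkinnerWan2017, §7.4.1 (arXiv:1512.06894 p. 30)] -/
theorem natCard_sha_torsionBy_pow_baseChange_quadratic_of_odd (p : ℕ) [hp : Fact p.Prime] (hp2 : p ≠ 2) (n : ℕ) :
    Nat.card ((W.baseChange K).sha[((p ^ n : ℕ) : ℤ)]) =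
      Nat.card (W.sha[((p ^ n : ℕ) : ℤ)]) * Nat.card ((W.quadraticTwist c).sha[((p ^ n : ℕ) : ℤ)]) := by
  haveI : (W.baseChange K).IsElliptic := by rw [baseChange]; infer_instance
  have hc0 : c ≠ 0 := by
    rintro rfl
    apply Quadratic.ne_zero_of_not_mem_range hθ
    have : θ ^ 2 = 0 := by rw [hc, map_zero]
    exact pow_eq_zero_iff (n := 2) (by norm_num) |>.mp this
  haveI : (W.quadraticTwist c).IsElliptic := W.isElliptic_quadraticTwist hc0
  have hS := natCard_torsionBy_selmerGroupPInfty_baseChange_eq_mul W K h2 hθ hc p hp2 (p ^ n)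
  rw [natCard_torsionBy_pow_selmerGroupPInfty_eq, natCard_torsionBy_pow_selmerGroupPInfty_eq,
    natCard_torsionBy_pow_selmerGroupPInfty_eq, mordellWeilRank_baseChange_eq_add W K h2 hθ hc, mul_add,
    pow_add] at hS
  have hpow : 0 < p ^ (n * W.mordellWeilRank) * p ^ (n * (W.quadraticTwist c).mordellWeilRank) :=
    Nat.mul_pos (pow_pos hp.out.pos _) (pow_pos hp.out.pos _)
  apply Nat.eq_of_mul_eq_mul_left hpow
  rw [hS]
  ring

include h2 hθ hc in
/-- Layer-by-layer closure: `Ш(E_K)[p^n] = 0 ⟺ Ш(E)[p^n] = 0 ∧ Ш(E^{(c)})[p^n] = 0` (odd `p`, in cardinalities).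
[cite: DokchitserDokchitserAnnals2010, Lemma 4.14 (proof)] -/
theorem natCard_sha_torsionBy_pow_baseChange_eq_one_iff_of_odd (p : ℕ) [hp : Fact p.Prime] (hp2 : p ≠ 2) (n : ℕ) :
    Nat.card ((W.baseChange K).sha[((p ^ n : ℕ) : ℤ)]) = 1 ↔
      Nat.card (W.sha[((p ^ n : ℕ) : ℤ)]) = 1 ∧ Nat.card ((W.quadraticTwist c).sha[((p ^ n : ℕ) : ℤ)]) = 1 := by
  rw [natCard_sha_torsionBy_pow_baseChange_quadratic_of_odd W K h2 hθ hc p hp2 n, mul_eq_one]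

/-- The discriminant form at every layer: `#Ш(E_K)[p^n] = #Ш(E)[p^n] · #Ш(E^{(d_K)})[p^n]` (odd `p`) for the tree's models
`W.baseChange K`, `W.quadraticTwist d_K`. [cite: DokchitserDokchitserAnnals2010, Lemma 4.14 (proof)] -/
theorem natCard_sha_torsionBy_pow_baseChange_quadratic_discr_of_odd (W : WeierstrassCurve ℚ) [W.IsElliptic]
    (K : Type) [Field K] [NumberField K] (h2 : Module.finrank ℚ K = 2) (p : ℕ) [Fact p.Prime] (hp2 : p ≠ 2)
    (n : ℕ) :
    Nat.card ((W.baseChange K).sha[((p ^ n : ℕ) : ℤ)]) =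
      Nat.card (W.sha[((p ^ n : ℕ) : ℤ)]) *
        Nat.card ((W.quadraticTwist (NumberField.discr K : ℚ)).sha[((p ^ n : ℕ) : ℤ)]) := by
  obtain ⟨θ, c, hθ, hc⟩ := Quadratic.exists_sq_eq_algebraMap (F := ℚ) (K := K) h2
  obtain ⟨q, hq, hd⟩ := NumberField.exists_discr_eq_mul_sq h2 hθ hc
  obtain ⟨C₁, hC₁⟩ := W.exists_variableChange_quadraticTwist_mul_sq c q hq
  rw [← hd] at hC₁
  rw [← hC₁, natCard_sha_torsionBy_variableChange]
  exact natCard_sha_torsionBy_pow_baseChange_quadratic_of_odd W K h2 hθ hc p hp2 n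

end QuadraticPow

end WeierstrassCurve

end
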